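import Summits.BirchSwinnertonDyer.BirchSwinnertonDyer.Theorems.EisensteinPrimesMazurMCOnX1RankZero
import Literature.NumberTheory.EllipticCurves.KuriharaNumber
import Literature.NumberTheory.ModularForms.RademacherPhiCompositionProofs
import HarnessLib

/-!
# Sketch — crux idea `eisenstein-jet-kolyvagin` on `MazurMCOnX1RankZero`
(stmt-BirchSwinnertonDyer-19035; planner seat bsd-eis-idea g13, 2026-08-28)

Typed shadows, over TREE declarations only (`kuriharaNumber`'s ingredients `ratPlusSymbol`,
`ratModP`; `frobeniusTrace`, `ClassX1`, `BSDp`, `IsIsogenous`, `torsionOrder`), of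

* the EISENSTEIN-JET objects: scaled Kurihara numbers `δ̃_n(c·[ ]⁺_f) ∈ ℤ/p^k` at type-A jet levels
  `n` (square-free products of primes `ℓ ≡ 1 (p^k)`, `a_ℓ ≡ ℓ + 1 (p)`, good, `≠ p`), their
  `p^k`-truncated valuations, and the level floors `jetFloor ν`;
* the four candidate statements of the card — `EisensteinJetDivisibility` (LAW 1, lower bound with
  jump parameter `j`; `j = 1` is the classical Eisenstein congruence, `j = L` = étale depth is new),
  `EisensteinJetSaturation` (floors attained at levels 1 and 2), `JetExactFormula` (Mazur–Rubin-type
  length formula for the Eisenstein-DIVIDED Kato–Kolyvagin system: `floor₁ − floor_∞ = ord_p #Ш(E₀)[p^∞]`),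
  `AnalyticJetLaw` (`floor₁ − floor_∞ = ord_p #Ш_an(E₀)`, a statement about modular symbols only);
* and the kernel-checked plumbing: `JetExactFormula ∧ AnalyticJetLaw ⟹ BSD(E₀,p)`-shape is recorded as
  the Prop `JetBSDpAtEtaleEnd`, and `typeSplit_mazurMCOnX1RankZero` proves the crux BY NAME from
  BSD_p on type-A pairs and BSD_p on type-B pairs via k5-c5's `mazurMCOnX1RankZero_iff_forall_bsdp`.
Nothing is asserted about elliptic curves; no `sorry`. Data: HOME `idea-g13/RESULTS.md` (28 classes).

**v2 (2026-08-28 ≈09:30Z).** Control runs (910e1@3, 858k1@7) REFUTE `JetExactFormula` and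
`AnalyticJetLaw` numerically (level 2 drops by one with `Ш_an(E₀) = 1`); both are kept with REFUTED
docstrings as recorded negatives. Added: `CuspidalJetLaw` (LAW 0: the first jet is Mazur's Eisenstein
homomorphism, i.e. `[a/n] − [0]` is an additive function of `n` mod `p^{v₀+L}`), `JetStaircase`
(LAW 2′: level 2 = `v₀ + L − min(1,v₀)`), and `ReduciblePrimitivityCriterion` (the v2 conclusion shape:
divided primitivity ⟹ Mazur MC — crux-strength, named, not claimed). RESULTS.md §v2.

**v3 (≈09:40Z, Finding K7 — DEFLATION).** The level-1 law is the Fricke functional equation in disguise (`kurihara_reflection` and `kuriharaLevelOneFormula_of_fricke : FrickePlusSymmetry f → KuriharaLevelOneFormula f c`, both PROVED; digits 113/113), odd levels are determined by lower ones, and level 2 sits at the natural modulus (`NaturalModulusVanishing`, 34/34): the "Eisenstein jets" carry no arithmetic information beyond `a_ℓ`, `[0]⁺` and the corank-0 signature; LAW 0 is refuted on `v₀ = 0, m_f = 0`. What stands: the K6 parity lemmas, LAW 0 on `m_f ≥ 1` (Mazur type), and the negative knowledge. **v2.1 (≈09:20Z, Finding K6).** The MECHANISM behind LAW 0 / LAW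 1's lower bound, over the tree's
`rademacherPhi` / `eisensteinPsi` (Rademacher–Grosswald Ch. 4): the period homomorphism of every
`ℚ`-Eisenstein series is ODD under `c = diag(1,−1)` (`rademacherPhi_conj_neg`, `eisensteinPsi_conj_neg`,
PROVED below, elementary), hence antisymmetric on every cusp-`0` fan modulo the width period
(`EisensteinPsiFanAntisymmetry`, PROVED as `eisensteinPsiFanAntisymmetry_holds` in v3.1; exact on 17 fans numerically) and so INVISIBLE to `+` modular symbols on
fans and annihilated by every Kurihara functional (`log_ℓ` is even and sums to `0` mod `p^k`): the jets of
a type-A class start strictly after its Eisenstein-series shadow — the same vanishing `L(χ,0) = 0`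
(`χ` even) that blocks Greenberg–Vatsal's `μ = 0` argument for even kernels. HOME `idea-g13/fals/K6_*`.
-/

set_option linter.dupNamespace false
set_option autoImplicit false

noncomputable section

open scoped Classical MatrixGroups ModularForm

open CongruenceSubgroup WeierstrassCurve
open Literature.NumberTheory.EllipticCurves Literature.NumberTheory.EllipticCurves.Rank1Residual
  Literature.NumberTheory.EllipticCurves.ModularForms
open Literature.NumberTheory.DiophantineGeometry.Dioph (ratModP)

namespace Summit.BirchSwinnertonDyer.BirchSwinnertonDyer.Cruxes.MazurMCOnX1RankZero.EisensteinJet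

variable {N : ℕ}

/-- Scaled Kurihara number: the tree's `kuriharaNumber` with every plus symbol multiplied by the
rational constant `c` BEFORE reduction mod `m` (at an Eisenstein prime the `Ω⁺_f`-normalised symbols
need not be `p`-integral; `c` moves them to the primitive integral lattice, cf. `IsPrimitiveScaling`). -/
def scaledKuriharaNumber (f : CuspForm (Gamma0 N) 2) (c : ℚ) (m n : ℕ) [NeZero n]
    (ψ : (ℓ : ℕ) → (ZMod ℓ)ˣ →* Multiplicative (ZMod m)) : ZMod m :=
  ∑ a : (ZMod n)ˣ, ratModP m (c * ratPlusSymbol f (((a : ZMod n).val : ℚ) / n)) *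
    ∏ ℓ ∈ n.primeFactors.attach,
      Multiplicative.toAdd (ψ ℓ.1 (ZMod.unitsMap (Nat.dvd_of_mem_primeFactors ℓ.2) a))

/-- `c` is a PRIMITIVE `p`-integral scaling of the plus symbol on the cusps `a/n`, `gcd(n, N) = 1`:
all `c·[a/n]⁺_f` are `p`-integral and at least one is a `p`-adic unit. -/
def IsPrimitiveScaling (f : CuspForm (Gamma0 N) 2) (p : ℕ) (c : ℚ) : Prop :=
  c ≠ 0 ∧ (∀ (n : ℕ) (a : ℤ), 0 < n → Nat.Coprime n N → ¬ p ∣ (c * ratPlusSymbol f (a / n)).den) ∧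
    ∃ (n : ℕ) (a : ℤ), 0 < n ∧ Nat.Coprime n N ∧ ¬ (p : ℤ) ∣ (c * ratPlusSymbol f (a / n)).num

/-- `v₀ := ord_p (c·[0]⁺_f)` (`[0]⁺ = L(f,1)/Ω⁺`), as a natural number (it is `≥ 0` under
`IsPrimitiveScaling`). -/
def vZero (f : CuspForm (Gamma0 N) 2) (p : ℕ) (c : ℚ) : ℕ :=
  (padicValRat p (c * ratPlusSymbol f 0)).toNat

/-- A type-A JET PRIME of precision `k` for `(W, p)`: `ℓ` prime, `ℓ ≠ p`, good for `W`,
`p^k ∣ ℓ − 1`, `p ∣ ℓ + 1 − a_ℓ(W)` (Kolyvagin condition mod `p` only — the data of RESULTS.md), and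
`E[p] ⊄ E(𝔽_ℓ)`, expressed as: the `p`-division polynomial of the reduction has fewer than
`(p² − 1)/2` distinct roots in `𝔽_ℓ`. -/
def IsJetPrime (W : WeierstrassCurve ℚ) [W.IsGloballyMinimal] (p k ℓ : ℕ) [Fact ℓ.Prime] : Prop :=
  ℓ ≠ p ∧ W.HasGoodReductionAtPrime ℓ ∧ (p ^ k : ℤ) ∣ (ℓ : ℤ) - 1 ∧
    (p : ℤ) ∣ (ℓ : ℤ) + 1 - W.frobeniusTrace ℓ ∧
    ((((integralModelInt W).map (Int.castRingHom (ZMod ℓ))).preΨ p).roots.toFinset.card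
      < (p ^ 2 - 1) / 2)

/-- A JET LEVEL of precision `k`: a square-free `n > 1` all of whose prime factors are jet primes. -/
def IsJetLevel (W : WeierstrassCurve ℚ) [W.IsGloballyMinimal] (p k n : ℕ) : Prop :=
  1 < n ∧ Squarefree n ∧
    ∀ (ℓ : ℕ) (h : ℓ ∈ n.primeFactors), @IsJetPrime W _ p k ℓ ⟨Nat.prime_of_mem_primeFactors h⟩

/-- Admissible discrete logarithms at precision `m`: surjective at every prime of `n`. -/
def IsAdmissibleLog (m n : ℕ) (ψ : (ℓ : ℕ) → (ZMod ℓ)ˣ →* Multiplicative (ZMod m)) : Prop :=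
  ∀ ℓ ∈ n.primeFactors, Function.Surjective (ψ ℓ)

/-- `p^k`-truncated valuation of `x ∈ ℤ/p^k`: the largest `i ≤ k` with `p^i ∣ x`. -/
def zmodVal (p k : ℕ) (x : ZMod (p ^ k)) : ℕ :=
  (Finset.range (k + 1)).sup fun i => if ((p : ZMod (p ^ k)) ^ i ∣ x) then i else 0

/-- The level-`ν` JET FLOOR of `(W, p, f, c)`: the infimum, over all precisions `k`, all jet levels
`n` of precision `k` with `ν` prime factors and all admissible logarithms, of the valuation of
`δ̃_n`, counted only when it is EXACT (strictly below the precision `k`); `⊤` if never exact. -/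
def jetFloor (W : WeierstrassCurve ℚ) [W.IsGloballyMinimal] (p : ℕ) (f : CuspForm (Gamma0 N) 2)
    (c : ℚ) (ν : ℕ) : ℕ∞ :=
  ⨅ (k : ℕ) (n : ℕ) (h : IsJetLevel W p k n ∧ n.primeFactors.card = ν)
    (ψ : (ℓ : ℕ) → (ZMod ℓ)ˣ →* Multiplicative (ZMod (p ^ k))) (_ : IsAdmissibleLog (p ^ k) n ψ),
    (if zmodVal p k (@scaledKuriharaNumber N f c (p ^ k) n ⟨by obtain ⟨⟨h1, -⟩, -⟩ := h; omega⟩ ψ)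
        < k then
      (zmodVal p k (@scaledKuriharaNumber N f c (p ^ k) n ⟨by obtain ⟨⟨h1, -⟩, -⟩ := h; omega⟩ ψ)
        : ℕ∞) else ⊤)

/-- The floor over ALL levels `ν ≥ 1`. -/
def jetFloorInf (W : WeierstrassCurve ℚ) [W.IsGloballyMinimal] (p : ℕ) (f : CuspForm (Gamma0 N) 2)
    (c : ℚ) : ℕ∞ :=
  ⨅ (ν : ℕ) (_ : 1 ≤ ν), jetFloor W p f c ν

/-- **[v3/K7: EXPLAINED — at level 1 a consequence of `KuriharaLevelOneFormula` (`v = v₀ + v_p(a_ℓ−2) + v_p(lg N)`), at level 2 of `NaturalModulusVanishing`; no information beyond `a_ℓ`, `[0]⁺` and the corank-0 signature.]** **LAW 1 (candidate, lower bound with jump `j`).** At every jet level `n > 1` the scaled Kurihara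
number is divisible by `p^{min(k, v₀ + j)}`. `j = 1`: the classical Eisenstein congruence of the plus
symbol (plausibly provable); `j = L(W,p)` (étale depth): the new law of RESULTS.md (25/27 classes exact,
0 violations in ≈ 330 primes, ≈ 190 pairs, ≈ 50 triples). -/
def EisensteinJetDivisibility (W : WeierstrassCurve ℚ) [W.IsGloballyMinimal] (p : ℕ)
    (f : CuspForm (Gamma0 N) 2) (c : ℚ) (j : ℕ) : Prop :=
  ∀ (k n : ℕ) (hn : IsJetLevel W p k n) (ψ : (ℓ : ℕ) → (ZMod ℓ)ˣ →* Multiplicative (ZMod (p ^ k))),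
    IsAdmissibleLog (p ^ k) n ψ →
      (p : ZMod (p ^ k)) ^ min k (vZero f p c + j) ∣
        @scaledKuriharaNumber N f c (p ^ k) n ⟨by rcases hn with ⟨h, _⟩; omega⟩ ψ

/-- **[v3/K7: EXPLAINED — bookkeeping, see the K7 section.]** **LAW 1 equality + level-2 bound (candidate; v2: 27/27 classes with level-2 data).** The floor
`v₀ + j` is ATTAINED at level 1, and level 2 does not exceed it (v2 LAW 2′: level 2 equals `v₀ + j`
when `v₀ = 0`, 24/24, and `v₀ + j − 1` when `v₀ ≥ 1`, 3/3 — see `JetStaircase`). -/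
def EisensteinJetSaturation (W : WeierstrassCurve ℚ) [W.IsGloballyMinimal] (p : ℕ)
    (f : CuspForm (Gamma0 N) 2) (c : ℚ) (j : ℕ) : Prop :=
  jetFloor W p f c 1 = (vZero f p c + j : ℕ) ∧ jetFloor W p f c 2 ≤ (vZero f p c + j : ℕ)

/-- **v1 EXACT FORMULA — REFUTED NUMERICALLY (v2, 2026-08-28): kept as a recorded negative, do not
staff.** `floor₁ − floor_∞ = ord_p #Ш(W)[p^∞]` fails at 910e1@3 and 858k1@7 (`Ш_an(E₀) = 1`, hence
`Ш(E₀)[p] = 0` by the Kato–Wuthrich upper bound, yet level 2 drops by exactly 1: RESULTS.md §v2.1).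
Structural reason (RESULTS.md §v2.3, closed-period reduction): every jet of level ≥ 1 is a functional of
the closed-period homomorphism `φ|_{H₁(X₀(N),ℤ)}` alone, hence isogeny-invariant up to the period scalar,
while `#Ш[p^∞]` is not isogeny-invariant. -/
def JetExactFormula (W : WeierstrassCurve ℚ) [W.IsGloballyMinimal] (p : ℕ)
    (f : CuspForm (Gamma0 N) 2) (c : ℚ) : Prop :=
  jetFloor W p f c 1 =
    jetFloorInf W p f c + (padicValNat p (Nat.card (AddCommGroup.primaryComponent W.sha p)) : ℕ∞)

/-- **v1 ANALYTIC JET LAW — REFUTED NUMERICALLY (v2): `floor₁ − floor_∞ = ord_p #Ш_an(W)` fails at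
910e1@3 and 858k1@7 (`Ш_an = 1`, drop 1). Recorded negative; the drop tracks `v₀`, see `JetStaircase`.** -/
def AnalyticJetLaw (W : WeierstrassCurve ℚ) [W.IsElliptic] [W.IsGloballyMinimal] (p : ℕ)
    (f : CuspForm (Gamma0 N) 2) (c : ℚ) : Prop :=
  ∃ q : ℚ, shaAn W = (q : ℂ) ∧
    jetFloor W p f c 1 = jetFloorInf W p f c + ((padicValRat p q).toNat : ℕ∞)

/-- **[v3: REFUTED on the stated domain `v₀ = 0` by falsifier (F0): 182b1@3, 434b1@3, 938d1@3, 1342c1@5 have `v₀ = 0` and fans NON-constant mod `p`. Survives exactly on cuspidal depth `m_f ≥ 1` (8/8: 11a3, 14a4, 19a3, 26a3, 35a3, 37b3 with content mod `p`; 26b1, 20a2 vacuous), fails on all 7 probed `m_f = 0` classes; on its true domain it is a Mazur-type log-class statement (K6: the `c`-even Eisenstein torsion classes), not new.]** **LAW 0 (v2 candidate; CUSPIDAL JET LAW = Mazur's Eisenstein homomorphism as the first jet).**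
With jump `j`: there is an ADDITIVE function `ε` on the integers coprime to the level such that for every
`n ⊥ N`, `n > 0`, and every `a ⊥ n`, `c·[a/n]⁺ ≡ c·[0]⁺ + ε(n) (mod p^{v₀+j})`. Observed with `j = L`
(étale depth) in every probed `v₀ = 0` class (11a3@5, 14a4@3, 26a3@3: `ε/p` = unit × tame character
through the punctured prime; 26b1@7, 20a2@3: `ε = 0`, `L = 1`), and it correctly FAILS when `v₀ ≥ 1`
(858k1@7, 2366d1@3). At prime level with `j = 2` it follows from Mazur's `H⁺/IH⁺ ≅ ℤ/p^s`,
`{∞, a/N} ↦ log a` plus cuspidal depth `m = 1` (RESULTS.md §v2.4). It implies the level-≥1 lower bound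
of `EisensteinJetDivisibility … j` for `v₀ = 0` (sum of the log-weights vanishes mod `p^k`). -/
def CuspidalJetLaw (N p : ℕ) (f : CuspForm (Gamma0 N) 2) (c : ℚ) (j : ℕ) : Prop :=
  ∃ ε : ℕ → ZMod (p ^ (vZero f p c + j)),
    (∀ n₁ n₂ : ℕ, Nat.Coprime n₁ N → Nat.Coprime n₂ N → ε (n₁ * n₂) = ε n₁ + ε n₂) ∧
    ∀ (n : ℕ) (a : ℤ), 0 < n → Nat.Coprime n N → IsCoprime a n →
      ratModP (p ^ (vZero f p c + j)) (c * ratPlusSymbol f (a / n)) =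
        ratModP (p ^ (vZero f p c + j)) (c * ratPlusSymbol f 0) + ε n

/-- **[v3/K7: EXPLAINED — level 1 inherits `v₀` from `[0]⁺` through the Fricke functional equation (`kurihara_reflection`); level 2 is free of it and sits at the natural modulus `w(n) = L` (+1 in the single `v₀ = 2` class, 2 pairs). Not an invariant.]** **LAW 2′ (v2 candidate; STAIRCASE + SATURATION, 27/27 classes with level-2 data).** Level 1 sits at
`v₀ + L` exactly and level 2 at `v₀ + L − min(1, v₀)` exactly: no drop when `v₀ = 0` (24/24), drop by
exactly one when `v₀ ≥ 1` (2366d1, 910e1, 858k1; first pairs of the `v₀ = 2` class 1990d1 consistent).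
In particular the `p^L`-divided value is a `p`-adic unit at some level `≤ 1 + v₀` when `v₀ ≤ 1`. -/
def JetStaircase (W : WeierstrassCurve ℚ) [W.IsGloballyMinimal] (p : ℕ)
    (f : CuspForm (Gamma0 N) 2) (c : ℚ) (L : ℕ) : Prop :=
  jetFloor W p f c 1 = (vZero f p c + L : ℕ) ∧
    jetFloor W p f c 2 = (vZero f p c + L - min 1 (vZero f p c) : ℕ)

/-- **[v3/K7: WITHDRAWN AS A LEVER — its hypotheses (divisibility by `p^{v₀+L}` and attainment) are now known to hold for bookkeeping reasons in every rank-0 type-A class, so the `def` below asserts Mazur's MC for all of them from nothing: it is the crux restated, kept only as a record.]** **(KKS-red) in crux currency (v2; the residually-REDUCIBLE primitivity criterion — crux-strength,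
named, not claimed).** For a rank-0 X1 pair `(W, p)` with `p ∣ #W(ℚ)_tors`, newform `f`, primitive
scaling `c`: if the Kurihara numbers are divisible by `p^{v₀+L}` at every jet level (`L` is then the
Eisenstein jump) and that bound is attained (the `p^L`-divided Kato–Kolyvagin data is PRIMITIVE —
certified numerically class by class, 27/27), then Mazur's main conjecture holds for `(W, p)`.
Irreducible analogue: Kim–Kim–Sun / Mazur–Rubin rigidity; here residual pair `(1, ω)`, `p` anomalous —
the case excluded by Castella–Grossi–Skinner-type hypotheses `φ|_{G_p} ≠ 1, ω`. -/
def ReduciblePrimitivityCriterion : Prop :=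
  ∀ (W : WeierstrassCurve ℚ) [W.IsElliptic] [W.IsGloballyMinimal] (p : ℕ) [Fact p.Prime]
    (N : ℕ) [NeZero N] (f : CuspForm (Gamma0 N) 2) (c : ℚ) (L : ℕ),
    ClassX1 W p → W.analyticRank = 0 → p ∣ W.torsionOrder → IsNewformOf W f →
      IsPrimitiveScaling f p c → EisensteinJetDivisibility W p f c L →
        EisensteinJetSaturation W p f c L →
          Summit.BirchSwinnertonDyer.BirchSwinnertonDyer.Theorems.Rank1ResidualX1Defs.MazurMainConjecture W p

/-- TYPE A: the rational isogeny class of `W` has a member with a rational point of order `p`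
(equivalently, for `ClassX1`, the even unramified kernel character is trivial). -/
def TypeA (W : WeierstrassCurve ℚ) (p : ℕ) : Prop :=
  ∃ (W' : WeierstrassCurve ℚ) (_ : W'.IsElliptic), IsIsogenous W W' ∧ p ∣ W'.torsionOrder

/-- (v1 conclusion shape — its hypotheses `JetExactFormula`/`AnalyticJetLaw` are refuted numerically in
v2, so this Prop is retained for the record only; the v2 conclusion shape is `ReduciblePrimitivityCriterion`.)
The line's v1 conclusion at the ÉTALE END, in crux currency: for a rank-0 X1 pair `(W, p)` with
`p ∣ #W(ℚ)_tors` (so `W = E₀` up to prime-to-`p` isogeny), its newform `f` and a primitive scaling `c`,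
the exact formula together with the analytic jet law give `BSD(W, p)`. (The implication itself needs
`Ш(W)[p^∞]` finite — Kato — and `r_MW = r_an = 0` — Gross–Zagier–Kolyvagin — which the card takes from
the route's published inputs; recorded here as a Prop, not proved.) -/
def JetBSDpAtEtaleEnd : Prop :=
  ∀ (W : WeierstrassCurve ℚ) [W.IsElliptic] [W.IsGloballyMinimal] (p : ℕ) [Fact p.Prime]
    (N : ℕ) [NeZero N] (f : CuspForm (Gamma0 N) 2) (c : ℚ),
    ClassX1 W p → W.analyticRank = 0 → p ∣ W.torsionOrder → IsNewformOf W f →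
      IsPrimitiveScaling f p c → JetExactFormula W p f c → AnalyticJetLaw W p f c → BSDp W p

open Summit.BirchSwinnertonDyer.BirchSwinnertonDyer.Theorems.EisensteinPrimesMazurMCOnX1RankZero in
/-- **Kernel-checked plumbing (proved).** The crux BY NAME from `BSD(E,p)` on the type-A rank-0 X1
pairs (the jet line's territory: 743/770 classes with `N < 2·10⁴`) and on the type-B ones (27/770;
crux 6 territory), via k5-c5's `mazurMCOnX1RankZero_iff_forall_bsdp` and its published inputs. -/
theorem typeSplit_mazurMCOnX1RankZero (hW16 : Wuthrich2014.charIdeal_dvd_padicLFunction)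
    (hGr : greenberg_charValue_rankZero) (hmod : nonempty_modularParametrizationData)
    (hGZK : rank_eq_analyticRank_of_analyticRank_le_one)
    (hA : ∀ (W : WeierstrassCurve ℚ) [W.IsElliptic] [W.IsGloballyMinimal] (p : ℕ) [Fact p.Prime],
      ClassX1 W p → W.analyticRank = 0 → TypeA W p → BSDp W p)
    (hB : ∀ (W : WeierstrassCurve ℚ) [W.IsElliptic] [W.IsGloballyMinimal] (p : ℕ) [Fact p.Prime],
      ClassX1 W p → W.analyticRank = 0 → ¬ TypeA W p → BSDp W p) :
    Summit.BirchSwinnertonDyer.BirchSwinnertonDyer.Theses.EisensteinPrimes.MazurMCOnX1RankZero := by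
  refine (mazurMCOnX1RankZero_iff_forall_bsdp hW16 hGr hmod hGZK).mpr ?_
  intro W _ _ p _ hX hr
  by_cases hT : TypeA W p
  · exact hA W p hX hr hT
  · exact hB W p hX hr hT


/-! ## K6 — parity of Eisenstein period homomorphisms (v2.1)

The tree's `eisensteinPsi t` is the period homomorphism on `Γ₀(t)` of `E₂(z) − tE₂(tz)`
(`eisensteinPsiSL_mul_of_mem_Gamma0'`, PROVED in `RademacherPhiCompositionProofs`). The cusp-`0` FAN of
denominator `ℓ` (`gcd(ℓ, N) = 1`) is `{γ_{a,ℓ} = (x a; y ℓ) ∈ Γ₀(N) : a ∈ (ℤ/ℓ)ˣ}`, `γ_{a,ℓ}·0 = a/ℓ`, and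
for a cusp form `f` on `Γ₀(N)`: `[a/ℓ]_f − [0]_f = ∫_{γ_{a,ℓ}} f` (closed period). Complex conjugation acts
by `γ ↦ cγc`, `c = diag(1,−1)`, i.e. `(x a; y ℓ) ↦ (x, −a; −y, ℓ)`, and `cγ_{a,ℓ}c · (1 0; N 1)` is a fan
matrix for `−a/ℓ`. Rademacher's `Φ` is odd under this (definition (59): `(a+d)/c` and `sign c` flip),
so every `Ψ_t` is odd; a `+` symbol is even. Consequences recorded in the memo §10 / NOTES K6:
(i) `Ψ_t(γ_{a,ℓ}) + Ψ_t(γ_{−a,ℓ}) = Ψ_t(1 0; N 1)` on every fan (K6-P2; with the representative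
`(x', ℓ−a; y', ℓ) = T·(cγc·L₀)` one sees `Ψ_t(T) + Ψ_t(L₀)`, as in `fals/K6_dr_fan_parity.log`, 17/17 exact);
(ii) hence `Σ_a Ψ_t(γ_{a,ℓ})·log_ℓ(a) ≡ 0 (mod p^k)` for `p^k ∣ ℓ − 1`, `p` odd (`log_ℓ` even, `Σ log_ℓ ≡ 0`)
— `fals/K6_eis_S.log` shows the would-be even term `ℓ·Σ B̄₂(a/ℓ)log_ℓ(a)` is NOT `0 (mod p^k)`, so the
vanishing is parity, not a Bernoulli identity; (iii) the `+` fan data `[a/n]⁺ − [0]⁺ (mod p^s)` of an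
Eisenstein-congruent newform never sees an Eisenstein SERIES: LAW 0's `ε(n)` is a `c`-EVEN torsion
class (`γ ↦ log(d_γ mod q)`, needs `p^s ∣ q − 1`, `q ∥ N`), forced to be `0` when no such `q` exists
(26b1@7, 20a2@3: constant fans, `ε = 0`), and absent at `v₀ ≥ 1` (858k1@7: no `q ≡ 1 (7)`, fans non-constant
mod 7; 2366d1@3: `q = 7 ≡ 1 (3)` exists but `v₀ = 1`, fans non-constant mod 3); (iv) every étale chain of
length `L = 2` below conductor `10⁴` (`p ∈ {3,5,7}`, 50 classes) has a puncture `q ∥ N`, `q ≡ 1 (mod p)`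
(`fals/K6_scanL2.log`). -/

section K6

open Literature.NumberTheory.ModularForms

/-- **K6-P1 (PROVED; elementary).** Rademacher's `Φ` is odd under conjugation by `diag(1,−1)`:
`Φ(a, −b; −c, d) = −Φ(a b; c d)`. From definition (59): for `c = 0`, `(−b)/d = −(b/d)`; for `c ≠ 0`,
`(a+d)/(−c) = −(a+d)/c`, `sign(−c) = −sign c`, `|−c| = |c|`. [cite: RademacherGrosswald1972, Ch. 4 A, eq. (59)] -/
theorem rademacherPhi_conj_neg (a b c d : ℤ) :
    rademacherPhi a (-b) (-c) d = -rademacherPhi a b c d := by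
  by_cases hc : c = 0
  · subst hc
    simp [rademacherPhi, neg_div]
  · rw [rademacherPhi_of_c_ne_zero (neg_ne_zero.mpr hc), rademacherPhi_of_c_ne_zero hc,
      Int.sign_neg, Int.natAbs_neg]
    push_cast
    rw [div_neg]
    ring

/-- **K6-P1′ (PROVED).** Hence the period function `Ψ_t` of `E₂(z) − tE₂(tz)` is odd under
`(a b; c d) ↦ (a, −b; −c, d)` whenever `t ∣ c` (so that `(−c)/t = −(c/t)` in `ℤ`).
[cite: RademacherGrosswald1972, Ch. 4 A, eq. (59)–(60)] -/
theorem eisensteinPsi_conj_neg (t : ℕ) (a b c d : ℤ) (ht : (t : ℤ) ∣ c) :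
    eisensteinPsi t a (-b) (-c) d = -eisensteinPsi t a b c d := by
  unfold eisensteinPsi
  rw [mul_neg, Int.neg_ediv_of_dvd ht, rademacherPhi_conj_neg, rademacherPhi_conj_neg]
  ring

/-- **K6-P2 (PROVED below as `eisensteinPsiFanAntisymmetry_holds`; exact on 17 fans, `fals/K6_dr_fan_parity.log`).** FAN ANTISYMMETRY of the
Eisenstein period homomorphism modulo the width-at-`0` period: for `(x a; y ℓ) ∈ Γ₀(N)`, `t ∣ N`,
the matrix `cγc·(1 0; N 1) = (x − aN, −a; Nℓ − y, ℓ) ∈ Γ₀(N)` carries `0` to `−a/ℓ` and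
`Ψ_t(x − aN, −a; Nℓ − y, ℓ) = Ψ_t(1 0; N 1) − Ψ_t(x a; y ℓ)`. Proof route: `eisensteinPsi_conj_neg` +
the homomorphism property `eisensteinPsiSL_mul_of_mem_Gamma0'` (tree, proved) — matrix bookkeeping only.
Consequence: on each fan `a ↦ Ψ_t(γ_{a,ℓ})` is odd modulo `Ψ_t(1 0; N 1)·ℤ`, so its `+` part and all its
Kurihara sums `Σ_a Ψ_t(γ_{a,ℓ}) log_ℓ(a) (mod p^k)`, `p^k ∣ ℓ − 1`, `p` odd, vanish.
[cite: RademacherGrosswald1972, Ch. 4 A, eq. (59)–(62)] -/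
def EisensteinPsiFanAntisymmetry : Prop :=
  ∀ (t N : ℕ) (x a y ℓ : ℤ), 0 < t → (t : ℤ) ∣ N → x * ℓ - a * y = 1 → (N : ℤ) ∣ y →
    eisensteinPsi t (x - a * N) (-a) (N * ℓ - y) ℓ = eisensteinPsi t 1 0 N 1 - eisensteinPsi t x a y ℓ

/-- **K6-P2 (PROVED, v3.1).** Fan antisymmetry: `Ψ_t(cγc · (1 0; N 1)) = Ψ_t(1 0; N 1) − Ψ_t(γ)` for
`γ = (x a; y ℓ) ∈ Γ₀(N)`, `t ∣ N` — from the homomorphism property on `Γ₀(t)` (tree, proved) and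
oddness under `c = diag(1,−1)` (`eisensteinPsi_conj_neg`). [cite: RademacherGrosswald1972, Ch. 4 A, eq. (59)–(62)] -/
theorem eisensteinPsiFanAntisymmetry_holds : EisensteinPsiFanAntisymmetry := by
  intro t N x a y ℓ ht htN hdet hNy
  have hty : (t : ℤ) ∣ y := dvd_trans htN hNy
  -- the conjugated fan matrix `cγc` and the width matrix `L₀ = (1 0; N 1)` as elements of `SL(2, ℤ)`
  let M : SL(2, ℤ) := ⟨!![x, -a; -y, ℓ], by rw [Matrix.det_fin_two_of]; linear_combination hdet⟩
  let L₀ : SL(2, ℤ) := ⟨!![1, 0; (N : ℤ), 1], by rw [Matrix.det_fin_two_of]; ring⟩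
  have hM : M ∈ CongruenceSubgroup.Gamma0 t := by
    rw [CongruenceSubgroup.Gamma0_mem]
    show (((-y : ℤ)) : ZMod t) = 0
    rw [ZMod.intCast_zmod_eq_zero_iff_dvd]
    exact (dvd_neg).mpr hty
  have hL : L₀ ∈ CongruenceSubgroup.Gamma0 t := by
    rw [CongruenceSubgroup.Gamma0_mem]
    show (((N : ℤ)) : ZMod t) = 0
    rw [ZMod.intCast_zmod_eq_zero_iff_dvd]
    exact htN
  have key := eisensteinPsiSL_mul_of_mem_Gamma0' ht hM hL
  -- read off the entries
  have e1 : eisensteinPsiSL t (M * L₀) = eisensteinPsi t (x - a * N) (-a) (N * ℓ - y) ℓ := by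
    simp only [eisensteinPsiSL, Matrix.SpecialLinearGroup.coe_mul, M, L₀, Matrix.mul_apply,
      Fin.sum_univ_two, Matrix.of_apply, Matrix.cons_val', Matrix.cons_val_zero, Matrix.cons_val_one,
      Matrix.empty_val', Matrix.cons_val_fin_one]
    ring_nf
  have e2 : eisensteinPsiSL t M = -eisensteinPsi t x a y ℓ := by
    simp only [eisensteinPsiSL, M, Matrix.of_apply, Matrix.cons_val', Matrix.cons_val_zero,
      Matrix.cons_val_one, Matrix.empty_val', Matrix.cons_val_fin_one]
    exact eisensteinPsi_conj_neg t x a y ℓ hty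
  have e3 : eisensteinPsiSL t L₀ = eisensteinPsi t 1 0 N 1 := by
    simp only [eisensteinPsiSL, L₀, Matrix.of_apply, Matrix.cons_val', Matrix.cons_val_zero,
      Matrix.cons_val_one, Matrix.empty_val', Matrix.cons_val_fin_one]
  rw [e1, e2, e3] at key
  rw [key]; ring

end K6

/-! ## K7 (v3, ≈09:40Z) — DEFLATION: odd-level Kurihara numbers are functional-equation bookkeeping

Numerically (fals/fe_test.py, 113/113 primes over 182b1@3, 66c1@5, 14a4@3, 190c1@3, 11a3@5; termwise
578/578): for a rank-0 newform (`f|W_N = −f`) the plus symbol satisfies the Fricke symmetry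
`[a/ℓ]⁺ = [(aN)⁻¹/ℓ]⁺`, and then PURE ALGEBRA (`kurihara_reflection`, proved below) gives
`2·δ̃_ℓ = −lg_ℓ(N) · Σ_{a ∈ (ℤ/ℓ)ˣ} c[a/ℓ]⁺ = −lg_ℓ(N)·(a_ℓ − 2)·c[0]⁺`. Hence LAW 1 at level 1
(`m₁ = v₀ + L`, 28/28) is a TAUTOLOGY: `v(δ̃_ℓ) = v₀ + v_p(a_ℓ − 2) + v_p(lg_ℓ N)` and
`min_ℓ v_p(a_ℓ − 2) = L` on type A. The same argument at level `ν` shows the top mixed derivative is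
determined by lower levels when `ν` is odd and free when `ν` is even. At level 2 every computed number
vanishes modulo its NATURAL MODULUS `p^{w(n)}`, `w(n) = min_{ℓ ∣ n} v_p(#W(𝔽_ℓ)) ≥ L` (34/34 pairs,
exact in 23) — the expected corank-0 signature. So `EisensteinJetDivisibility`, `EisensteinJetSaturation`
and `JetStaircase` carry no information beyond `a_ℓ`, `[0]` and that signature; `CuspidalJetLaw` (LAW 0)
is REFUTED on its stated domain `v₀ = 0` (182b1@3, 434b1@3, 938d1@3, 1342c1@5: fans non-constant mod p)
and survives only for cuspidal depth `m_f ≥ 1` (8/8), where it is of Mazur type. -/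

section K7

/-- **K7 (PROVED): the reflection identity.** For any coefficient function `φ` on a finite commutative
group invariant under `a ↦ (a·u)⁻¹` and any logarithm `ψ`, twice the `ψ`-weighted sum is `−ψ(u)` times
the plain sum. With `ι = (ℤ/ℓ)ˣ`, `φ a = c[a/ℓ]⁺ mod p^k`, `u = N`: level-1 Kurihara numbers of a
Fricke-antisymmetric form are determined by the augmentation. -/
theorem kurihara_reflection {ι R : Type*} [CommGroup ι] [Fintype ι] [CommRing R]
    (φ : ι → R) (ψ : ι →* Multiplicative R) (u : ι) (hφ : ∀ a, φ (a * u)⁻¹ = φ a) :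
    2 * ∑ a, φ a * Multiplicative.toAdd (ψ a)
      = -(Multiplicative.toAdd (ψ u)) * ∑ a, φ a := by
  let e : ι ≃ ι := (Equiv.mulRight u).trans (Equiv.inv ι)
  have he : ∀ a, e a = (a * u)⁻¹ := fun a => rfl
  have hS : ∑ a, φ ((a * u)⁻¹) * Multiplicative.toAdd (ψ ((a * u)⁻¹))
      = ∑ a, φ a * Multiplicative.toAdd (ψ a) :=
    Fintype.sum_equiv e _ _ (fun a => by rw [he])
  have h2 : ∑ a, φ a * Multiplicative.toAdd (ψ a)
      = ∑ a, (-(φ a * Multiplicative.toAdd (ψ a)) - Multiplicative.toAdd (ψ u) * φ a) := by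
    rw [← hS]
    refine Finset.sum_congr rfl (fun a _ => ?_)
    rw [hφ a, map_inv, map_mul, toAdd_inv, toAdd_mul]
    ring
  have h3 : ∑ a, φ a * Multiplicative.toAdd (ψ a)
      = -(∑ a, φ a * Multiplicative.toAdd (ψ a)) - Multiplicative.toAdd (ψ u) * ∑ a, φ a := by
    conv_lhs => rw [h2]
    rw [Finset.sum_sub_distrib, Finset.sum_neg_distrib, ← Finset.mul_sum]
  linear_combination h3

/-- **Fricke symmetry of the plus symbol (hypothesis; holds when `f|W_N = −f`, i.e. root number `+1` —
every rank-0 class; numerically 578/578).** `[a/ℓ]⁺ = [(aN)⁻¹/ℓ]⁺` for primes `ℓ ∤ N` and units `a`. -/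
def FrickePlusSymmetry (f : CuspForm (Gamma0 N) 2) : Prop :=
  ∀ (ℓ : ℕ) [Fact ℓ.Prime] (hN : Nat.Coprime N ℓ) (a : (ZMod ℓ)ˣ),
    ratPlusSymbol f (((a : ZMod ℓ).val : ℚ) / ℓ)
      = ratPlusSymbol f (((((a * ZMod.unitOfCoprime N hN)⁻¹ : (ZMod ℓ)ˣ) : ZMod ℓ).val : ℚ) / ℓ)

/-- **K7 level-1 formula (typed consequence; = `kurihara_reflection` + `FrickePlusSymmetry`, 113/113).**
At a prime level `ℓ ∤ N`: `2·δ̃_ℓ = −lg_ℓ(N) · Σ_a (c[a/ℓ]⁺ mod m)`; with the Hecke relation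
`Σ_{a ∈ (ℤ/ℓ)ˣ} [a/ℓ]⁺ = (a_ℓ − 2)[0]⁺` this is `−lg_ℓ(N)(a_ℓ − 2)c[0]⁺`, so
`v_p(δ̃_ℓ) = v₀ + v_p(a_ℓ − 2) + v_p(lg_ℓ N)` (capped at the precision): LAW 1 at level 1 is bookkeeping. -/
def KuriharaLevelOneFormula (f : CuspForm (Gamma0 N) 2) (c : ℚ) : Prop :=
  ∀ (m ℓ : ℕ) [Fact ℓ.Prime] (hN : Nat.Coprime N ℓ)
    (ψ : (q : ℕ) → (ZMod q)ˣ →* Multiplicative (ZMod m)),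
    2 * scaledKuriharaNumber f c m ℓ ψ
      = -(Multiplicative.toAdd (ψ ℓ (ZMod.unitOfCoprime N hN))) *
          ∑ a : (ZMod ℓ)ˣ, ratModP m (c * ratPlusSymbol f (((a : ZMod ℓ).val : ℚ) / ℓ))


/-- Single-factor evaluation of the dependent product over the prime factors of a prime. -/
theorem prod_attach_primeFactors_prime {M : Type*} [CommMonoid M] (ℓ : ℕ) (hℓ : ℓ.Prime)
    (F : (q : ℕ) → q ∣ ℓ → M) :
    ∏ q ∈ ℓ.primeFactors.attach, F q.1 (Nat.dvd_of_mem_primeFactors q.2) = F ℓ dvd_rfl := by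
  have hs : ℓ.primeFactors = {ℓ} := hℓ.primeFactors
  have hmem : ℓ ∈ ℓ.primeFactors := by rw [hs]; exact Finset.mem_singleton_self ℓ
  have hatt : ℓ.primeFactors.attach = {⟨ℓ, hmem⟩} := by
    ext x
    simp only [Finset.mem_attach, Finset.mem_singleton, true_iff]
    apply Subtype.ext
    exact (Nat.prime_dvd_prime_iff_eq (Nat.prime_of_mem_primeFactors x.2) hℓ).mp
      (Nat.dvd_of_mem_primeFactors x.2)
  rw [hatt, Finset.prod_singleton]

/-- **K7 (PROVED): the level-1 formula follows from Fricke symmetry alone.** -/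
theorem kuriharaLevelOneFormula_of_fricke (f : CuspForm (Gamma0 N) 2) (c : ℚ)
    (hF : FrickePlusSymmetry f) : KuriharaLevelOneFormula f c := by
  intro m ℓ _ hN ψ
  have hℓ : ℓ.Prime := Fact.out
  unfold scaledKuriharaNumber
  have hprod : ∀ a : (ZMod ℓ)ˣ,
      (∏ q ∈ ℓ.primeFactors.attach, Multiplicative.toAdd
          (ψ q.1 (ZMod.unitsMap (Nat.dvd_of_mem_primeFactors q.2) a)))
        = Multiplicative.toAdd (ψ ℓ a) := by
    intro a
    rw [prod_attach_primeFactors_prime ℓ hℓ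
      (fun q hq => Multiplicative.toAdd (ψ q (ZMod.unitsMap hq a)))]
    simp [ZMod.unitsMap_self]
  simp_rw [hprod]
  exact kurihara_reflection (R := ZMod m)
    (fun a : (ZMod ℓ)ˣ => ratModP m (c * ratPlusSymbol f (((a : ZMod ℓ).val : ℚ) / ℓ)))
    (ψ ℓ) (ZMod.unitOfCoprime N hN) (fun a => by rw [hF ℓ hN a])

/-- Natural modulus exponent of a level at precision `k`: `min(k, min_{ℓ ∣ n} v_p(ℓ + 1 − a_ℓ(W)))`
(`v_p(ℓ + 1 − a_ℓ) = v_p #W(𝔽_ℓ)`; written as `k − max_ℓ (k − min(k, ·))` to stay inside `ℕ`). -/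
def naturalModulus (W : WeierstrassCurve ℚ) [W.IsGloballyMinimal] (p k n : ℕ) : ℕ :=
  k - n.primeFactors.sup fun ℓ => k - min k (padicValInt p ((ℓ : ℤ) + 1 - W.frobeniusTrace ℓ))

/-- **K7 NATURAL-MODULUS VANISHING (candidate; level 2: 34/34 pairs over 11a3@5, 182b1@3, 910e1@3,
858k1@7, 1990d1@3, 246b1@5, exact in 23; level 1 ⟸ `KuriharaLevelOneFormula`).** Every scaled Kurihara
number at a jet level `n` of precision `k` is divisible by `p^{min(k, w(n))}`, `w(n) ≥ L` on type A
(`p^L ∣ #W(𝔽_ℓ)` for `ℓ ≡ 1 mod p^L`). Beyond this modulus the digits are explicit (`a_ℓ − 2`-multiples)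
and carry no Selmer information; modulo it everything computed VANISHES — the corank-0 signature that a
Kurihara structure theorem would predict from `Ш(W)[p] = 0`; in the residually reducible case that theorem
is missing (this is where the line meets the crux, cf. `ReduciblePrimitivityCriterion`). -/
def NaturalModulusVanishing (W : WeierstrassCurve ℚ) [W.IsGloballyMinimal] (p : ℕ)
    (f : CuspForm (Gamma0 N) 2) (c : ℚ) : Prop :=
  ∀ (k n : ℕ) (hn : IsJetLevel W p k n) (ψ : (ℓ : ℕ) → (ZMod ℓ)ˣ →* Multiplicative (ZMod (p ^ k))),
    IsAdmissibleLog (p ^ k) n ψ →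
      (p : ZMod (p ^ k)) ^ naturalModulus W p k n ∣
        @scaledKuriharaNumber N f c (p ^ k) n ⟨by rcases hn with ⟨h, _⟩; omega⟩ ψ

end K7


end Summit.BirchSwinnertonDyer.BirchSwinnertonDyer.Cruxes.MazurMCOnX1RankZero.EisensteinJet

end
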